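import Summits.SmoothPoincare4.SmoothPoincare4.Theses.SymplecticOrigami
import Literature.Topology.FourManifolds.Morse
import Summits.SmoothPoincare4.SmoothPoincare4.Theorems.SymplecticOrigamiOrigamiRungStubBallFunctionCalculus
import Summits.SmoothPoincare4.SmoothPoincare4.Theorems.SymplecticOrigamiOrigamiRungStubBallFunctionLocal
import Summits.SmoothPoincare4.SmoothPoincare4.Theorems.SymplecticOrigamiOrigamiRungStubBallFunctionChart

/-!
# Stub `stub_ballFunction` of line `pair-rigidity-endgame` (crux `SymplecticOrigami.OrigamiRung`)

Given the non-symplectic fold data on a closed `4`-manifold `M` (pieces `V 0`, `V 1` with common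
frontier the fold `Z`, blow-down maps `β i : M → N i` collapsing `Z` onto a surface
`B i = range (b i)`), the two-sidedness of the fold (`stub_sides`) and an affine pair structure
`(Ψ, Θ, W)` on `(N i, B i)` (`Ψ : N i ∖ B i ≅ ℝ⁴`, `Θ` = the sphere inversion of `Ψ` extended
smoothly by `0` across `B i` with `2`-dimensional kernel there), we construct an open
`Ω ⊇ closure (V i)` and a smooth `f : Ω → ℝ` with `{f ≤ 0} = closure (V i)`, `{f = 0} = Z`,
regular along `Z`, and with exactly one critical point `p` in `{f ≤ 0}`, a non-degenerate minimum.

Construction. `F = Ψ ∘ β i` is a smooth bijection `V i → ℝ⁴` with bijective differential; put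
`p = F⁻¹ 0` and `f = -(√(1 + ‖F‖²))⁻¹` on `V i` (part 2: its only critical point is the zero of
`F`, where the Hessian is `⟪dF ·, dF ·⟫`). Near `Z`, `G = Θ ∘ β i` is smooth, vanishes on `Z` and
has `dG ≠ 0` there (rank count: `dim ker dβ = 1`, `dim ker dΘ = 2`, `1 + 2 < 4`), so the signed
norm `σ = ± ‖G‖` (`+` on `closure (V i)`) is smooth near `Z` with `dσ ≠ 0` on `Z` (part 3,
Hadamard's lemma in a slice chart of `Z`); as `G = ι ∘ F` on `V i` near `Z`, `σ = ‖F‖⁻¹` there and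
`f = ρ ∘ σ` with the odd profile `ρ s = -s (√(1 + s²))⁻¹`, which defines the extension of `f`
across `Z`.
-/

noncomputable section

-- the prescribed namespace `Summit.<P>.<Sub>.…` duplicates `SmoothPoincare4` (P = Sub)
set_option linter.dupNamespace false

open scoped Manifold ContDiff Topology ContinuousMap
open Set TopologicalSpace
open Literature.Topology.FourManifolds (singularHomologyZ sphereInversion IsTwistedSphere)
open Literature.Geometry.Kaehler (MForm IsSmoothForm IsClosedForm)

namespace Summit.SmoothPoincare4.SmoothPoincare4.Theorems.OrigamiRung.PairRigidityEndgame

/-- Model space `ℝⁿ`. -/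
local notation "𝔼" n:arg => EuclideanSpace ℝ (Fin n)

/-- **Stub `stub_ballFunction` — the ball function of a folded piece.** For the fold data
`(V, N, S, b, β)` on a closed `4`-manifold `M` with two-sided fold `Z = (V 0 ∪ V 1)ᶜ`, and an
affine pair structure `(Ψ, Θ, W)` on `(N i, range (b i))`, there are an open `Ω ⊇ closure (V i)`,
a function `f` smooth on `Ω` and a point `p ∈ V i` with `{x ∈ Ω | f x ≤ 0} = closure (V i)`,
`{x ∈ Ω | f x = 0} = Z`, `f p < 0`, `p` the only critical point of `f` in `{f ≤ 0}`, and the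
Hessian of `f` at `p` positive definite. See the module docstring for the construction
(`F = Ψ ∘ β i`, `G = Θ ∘ β i`, signed norm of `G` across `Z`, odd/even profiles). [folklore] -/
theorem stub_ballFunction :
    ∀ (M : Type) [TopologicalSpace M] [T2Space M] [SecondCountableTopology M] [CompactSpace M]
      [ConnectedSpace M] [ChartedSpace (𝔼 4) M] [IsManifold (𝓡 4) ∞ M]
      (V : Fin 2 → Opens M) (N : Fin 2 → Type) [∀ i, TopologicalSpace (N i)]
      [∀ i, T2Space (N i)] [∀ i, SecondCountableTopology (N i)] [∀ i, CompactSpace (N i)]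
      [∀ i, ConnectedSpace (N i)] [∀ i, ChartedSpace (𝔼 4) (N i)] [∀ i, IsManifold (𝓡 4) ∞ (N i)]
      (S : Fin 2 → Type) [∀ i, TopologicalSpace (S i)] [∀ i, CompactSpace (S i)]
      [∀ i, ConnectedSpace (S i)] [∀ i, ChartedSpace (𝔼 2) (S i)] [∀ i, IsManifold (𝓡 2) ∞ (S i)]
      (b : ∀ i, S i → N i) (β : ∀ i, M → N i),
      (Disjoint (V 0) (V 1) ∧ (∀ i, (V i : Set M).Nonempty) ∧
        IsConnected ((V 0 : Set M) ∪ (V 1 : Set M))ᶜ ∧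
        (∃ (Z : Type) (_ : TopologicalSpace Z) (_ : ChartedSpace (𝔼 3) Z)
          (_ : IsManifold (𝓡 3) ∞ Z) (z : Z → M), Manifold.IsSmoothEmbedding (𝓡 3) (𝓡 4) ∞ z ∧
            Set.range z = ((V 0 : Set M) ∪ (V 1 : Set M))ᶜ)) →
      (∀ i, Manifold.IsSmoothEmbedding (𝓡 2) (𝓡 4) ∞ (b i) ∧
        (∃ U : Set M, IsOpen U ∧ closure (V i : Set M) ⊆ U ∧ ContMDiffOn (𝓡 4) (𝓡 4) ∞ (β i) U) ∧
        Set.InjOn (β i) (V i : Set M) ∧ β i '' (V i : Set M) = (Set.range (b i))ᶜ ∧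
        (∀ x ∈ (V i : Set M), Function.Bijective (mfderiv (𝓡 4) (𝓡 4) (β i) x)) ∧
        β i '' frontier (V i : Set M) ⊆ Set.range (b i) ∧
        (∀ x ∈ frontier (V i : Set M),
          Module.finrank ℝ (LinearMap.ker (mfderiv (𝓡 4) (𝓡 4) (β i) x).toLinearMap) = 1)) →
      (∀ i, frontier (V i : Set M) = ((V 0 : Set M) ∪ (V 1 : Set M))ᶜ ∧
        interior (closure (V i : Set M)) = (V i : Set M)) →
      ∀ i, (∃ (Ψ Θ : N i → 𝔼 4) (W : Set (N i)),
          ContMDiffOn (𝓡 4) 𝓘(ℝ, 𝔼 4) ∞ Ψ (Set.range (b i))ᶜ ∧ Set.InjOn Ψ (Set.range (b i))ᶜ ∧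
          Ψ '' (Set.range (b i))ᶜ = Set.univ ∧
          (∀ x ∈ (Set.range (b i))ᶜ, Function.Bijective (mfderiv (𝓡 4) 𝓘(ℝ, 𝔼 4) Ψ x)) ∧
          IsOpen W ∧ Set.range (b i) ⊆ W ∧ ContMDiffOn (𝓡 4) 𝓘(ℝ, 𝔼 4) ∞ Θ W ∧
          (∀ x ∈ W \ Set.range (b i), Θ x = sphereInversion (Ψ x)) ∧
          (∀ x ∈ Set.range (b i), Θ x = 0 ∧
            Module.finrank ℝ (LinearMap.ker (mfderiv (𝓡 4) 𝓘(ℝ, 𝔼 4) Θ x).toLinearMap) = 2)) →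
        ∃ (Ω : Set M) (f : M → ℝ) (p : M), IsOpen Ω ∧ ContMDiffOn (𝓡 4) 𝓘(ℝ, ℝ) ∞ f Ω ∧
          closure (V i : Set M) ⊆ Ω ∧ {x | x ∈ Ω ∧ f x ≤ 0} = closure (V i : Set M) ∧
          {x | x ∈ Ω ∧ f x = 0} = ((V 0 : Set M) ∪ (V 1 : Set M))ᶜ ∧
          p ∈ (V i : Set M) ∧ f p < 0 ∧
          (∀ x ∈ Ω, f x ≤ 0 → mfderiv (𝓡 4) 𝓘(ℝ, ℝ) f x = 0 → x = p) ∧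
          mfderiv (𝓡 4) 𝓘(ℝ, ℝ) f p = 0 ∧
          (Literature.Topology.FourManifolds.mhessian (𝓡 4) f p).toQuadraticMap.PosDef := by
  intro M _ _ _ _ _ _ _ V N _ _ _ _ _ _ _ S _ _ _ _ _ b β hfold hdata hsides i hpair
  classical
  obtain ⟨-, -, -, Z, _, _, _, z, hz, hZ⟩ := hfold
  obtain ⟨hb, ⟨U, hUo, hclU, hβ⟩, hβinj, hβA, hdβ, hβfr, hker⟩ := hdata i
  obtain ⟨hfr, hro⟩ := hsides i
  obtain ⟨Ψ, Θ, W, hΨ, hΨinj, hΨsurj, hdΨ, hWo, hBW, hΘ, hΘeq, hΘB⟩ := hpair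
  -- notation: the piece `A`, the fold `K`, the surface `B`
  set A : Set M := (V i : Set M) with hA_def
  set K : Set M := ((V 0 : Set M) ∪ (V 1 : Set M))ᶜ with hK_def
  set B : Set (N i) := Set.range (b i) with hB_def
  have hAo : IsOpen A := (V i).isOpen
  have hKcl : K ⊆ closure A := hfr ▸ frontier_subset_closure
  have hAK : Disjoint A K := by
    rw [← hfr, disjoint_iff_inter_eq_empty]
    exact hAo.inter_frontier_eq
  have hclA : closure A = A ∪ K := by rw [← hfr, closure_eq_self_union_frontier]
  have hKU : K ⊆ U := hKcl.trans hclU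
  have hAU : A ⊆ U := subset_closure.trans hclU
  have hBc : IsClosed B := (isCompact_range hb.contMDiff.continuous).isClosed
  have hβAc : ∀ x ∈ A, β i x ∈ Bᶜ := fun x hx => by
    rw [← hβA]
    exact mem_image_of_mem _ hx
  have hβK : ∀ x ∈ K, β i x ∈ B := fun x hx => hβfr (mem_image_of_mem _ (hfr.symm ▸ hx))
  have hGK : ∀ x ∈ K, Θ (β i x) = 0 := fun x hx => (hΘB _ (hβK x hx)).1
  -- the maps `G = Θ ∘ β` (near the fold) and `F = Ψ ∘ β` (on the piece)
  set O₀ : Set M := U ∩ β i ⁻¹' W with hO₀_def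
  have hO₀o : IsOpen O₀ := hβ.continuousOn.isOpen_inter_preimage hUo hWo
  have hKO₀ : K ⊆ O₀ := fun x hx => ⟨hKU hx, hBW (hβK x hx)⟩
  set G : M → 𝔼 4 := Θ ∘ β i with hG_def
  set F : M → 𝔼 4 := Ψ ∘ β i with hF_def
  have hGs : ContMDiffOn (𝓡 4) 𝓘(ℝ, 𝔼 4) ∞ G O₀ :=
    hΘ.comp (hβ.mono inter_subset_left) fun x hx => hx.2
  have hFs : ContMDiffOn (𝓡 4) 𝓘(ℝ, 𝔼 4) ∞ F A := hΨ.comp (hβ.mono hAU) fun x hx => hβAc x hx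
  have hGι : ∀ x ∈ A ∩ O₀, G x = sphereInversion (F x) := fun x hx =>
    hΘeq _ ⟨hx.2.2, hβAc x hx.1⟩
  have hGK' : ∀ x ∈ K, G x = 0 := fun x hx => hGK x hx
  have hG0 : ∀ x ∈ O₀ ∩ Set.range z, G x = 0 := fun x hx => hGK' x (hZ ▸ hx.2)
  -- `dG ≠ 0` along the fold: rank count
  have hdG : ∀ x ∈ K, mfderiv (𝓡 4) 𝓘(ℝ, 𝔼 4) G x ≠ 0 := by
    intro x hx
    have hxfr : x ∈ frontier A := hfr.symm ▸ hx
    have hβd : MDifferentiableAt (𝓡 4) (𝓡 4) (β i) x :=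
      (hβ.contMDiffAt (hUo.mem_nhds (hKU hx))).mdifferentiableAt (by simp)
    have hΘd : MDifferentiableAt (𝓡 4) 𝓘(ℝ, 𝔼 4) Θ (β i x) :=
      (hΘ.contMDiffAt (hWo.mem_nhds (hBW (hβK x hx)))).mdifferentiableAt (by simp)
    haveI : FiniteDimensional ℝ (TangentSpace (𝓡 4) x) :=
      inferInstanceAs (FiniteDimensional ℝ (𝔼 4))
    haveI : FiniteDimensional ℝ (TangentSpace (𝓡 4) (β i x)) :=
      inferInstanceAs (FiniteDimensional ℝ (𝔼 4))
    have hV : Module.finrank ℝ (TangentSpace (𝓡 4) x) = 4 := finrank_euclideanSpace_fin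
    have h := comp_ne_zero_of_finrank_ker (mfderiv (𝓡 4) (𝓡 4) (β i) x).toLinearMap
      (mfderiv (𝓡 4) 𝓘(ℝ, 𝔼 4) Θ (β i x)).toLinearMap
      (by rw [hker x hxfr, (hΘB _ (hβK x hx)).2, hV]; norm_num)
    rw [← ContinuousLinearMap.toLinearMap_comp, ← mfderiv_comp x hΘd hβd] at h
    intro h0
    apply h
    rw [show mfderiv (𝓡 4) 𝓘(ℝ, 𝔼 4) (Θ ∘ β i) x = 0 from h0]
    rfl
  -- the signed norm `σ` of `G`, smooth near the fold with `dσ ≠ 0` on it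
  set σ : M → ℝ := fun x => if x ∈ closure A then ‖G x‖ else -‖G x‖ with hσ_def
  have hσ₁ : ∀ x ∈ closure A, σ x = ‖G x‖ := fun x hx => if_pos hx
  have hσ₂ : ∀ x, x ∉ closure A → σ x = -‖G x‖ := fun x hx => if_neg hx
  have hfrZ : frontier A = Set.range z := hfr.trans hZ.symm
  have hloc : ∀ x ∈ K, ∃ O : Set M, IsOpen O ∧ x ∈ O ∧ O ⊆ O₀ ∧
      ContMDiffOn (𝓡 4) 𝓘(ℝ, ℝ) ∞ σ O ∧ (∀ y ∈ O ∩ K, mfderiv (𝓡 4) 𝓘(ℝ, ℝ) σ y ≠ 0) ∧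
      (∀ y ∈ O, y ∉ K → G y ≠ 0) := by
    intro x hx
    have hx' : x ∈ Set.range z := hZ.symm ▸ hx
    obtain ⟨q, rfl⟩ := hx'
    have h := signedNorm_local hz hAo hfrZ hro hO₀o hGs hG0 (hKO₀ hx) (hdG _ hx) hσ₁ hσ₂
    rw [hZ] at h
    exact h
  choose! O hOo hxO hOO₀ hσO hdσ hGne using hloc
  -- the centre `p = F⁻¹ 0` and the function `f`
  obtain ⟨p, hpA, hFp⟩ : ∃ p ∈ A, F p = 0 := by
    have h0 : (0 : 𝔼 4) ∈ Ψ '' Bᶜ := by rw [hΨsurj]; exact mem_univ _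
    obtain ⟨y, hy, hy0⟩ := h0
    rw [← hβA] at hy
    obtain ⟨p, hp, rfl⟩ := hy
    exact ⟨p, hp, hy0⟩
  set f : M → ℝ := fun x =>
    if x ∈ A then -(√(1 + ‖F x‖ ^ 2))⁻¹ else ‖G x‖ * (√(1 + ‖G x‖ ^ 2))⁻¹ with hf_def
  have hfA : ∀ x ∈ A, f x = -(√(1 + ‖F x‖ ^ 2))⁻¹ := fun x hx => if_pos hx
  have hfA' : ∀ x, x ∉ A → f x = ‖G x‖ * (√(1 + ‖G x‖ ^ 2))⁻¹ := fun x hx => if_neg hx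
  have hfneg : ∀ x ∈ A, f x < 0 := fun x hx => by
    rw [hfA x hx]
    exact neg_lt_zero.2 (inv_pos.2 (Real.sqrt_pos.2 (by positivity)))
  have hfK : ∀ x ∈ K, f x = 0 := fun x hx => by
    rw [hfA' x (hAK.notMem_of_mem_right hx), hGK' x hx, norm_zero, zero_mul]
  have hfpos : ∀ x ∈ K, ∀ y ∈ O x, y ∉ closure A → 0 < f y := by
    intro x hx y hy hyc
    have hyA : y ∉ A := fun h => hyc (subset_closure h)
    rw [hfA' y hyA]
    exact mul_pos (norm_pos_iff.2 (hGne x hx y hy fun h => hyc (hKcl h)))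
      (inv_pos.2 (Real.sqrt_pos.2 (by positivity)))
  -- near the fold, `f = ρ ∘ σ` with the odd profile `ρ s = -s (√(1 + s²))⁻¹`
  have hfρ : ∀ x ∈ K, ∀ y ∈ O x, f y = -σ y * (√(1 + σ y ^ 2))⁻¹ := by
    intro x hx y hy
    by_cases hyA : y ∈ A
    · have hGy : G y = sphereInversion (F y) := hGι y ⟨hyA, hOO₀ x hx hy⟩
      have hGne' : G y ≠ 0 := hGne x hx y hy (hAK.notMem_of_mem_left hyA)
      have hFne : F y ≠ 0 := fun h => hGne' (by
        rw [hGy, h, Literature.Topology.FourManifolds.sphereInversion.apply_zero])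
      rw [hfA y hyA, hσ₁ y (subset_closure hyA), hGy,
        Literature.Topology.FourManifolds.sphereInversion.norm_apply,
        oddProfile_inv (norm_pos_iff.2 hFne)]
    · by_cases hyc : y ∈ closure A
      · have hyK : y ∈ K := by
          rw [hclA] at hyc
          exact hyc.resolve_left hyA
        rw [hfK y hyK, hσ₁ y (hKcl hyK), hGK' y hyK, norm_zero]
        simp
      · rw [hfA' y hyA, hσ₂ y hyc, oddProfile_neg]
  -- the domain `Ω`
  set Ω : Set M := A ∪ ⋃ x ∈ K, O x with hΩ_def
  have hΩo : IsOpen Ω := hAo.union (isOpen_biUnion fun x hx => hOo x hx)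
  have hKΩ : ∀ x ∈ K, x ∈ Ω := fun x hx => Or.inr (mem_biUnion hx (hxO x hx))
  have hclΩ : closure A ⊆ Ω := by
    rw [hclA]
    exact union_subset subset_union_left fun x hx => hKΩ x hx
  have hΩcases : ∀ y ∈ Ω, y ∈ A ∨ ∃ x ∈ K, y ∈ O x := by
    rintro y (hy | hy)
    · exact Or.inl hy
    · obtain ⟨x, hx, hyx⟩ := mem_iUnion₂.1 hy
      exact Or.inr ⟨x, hx, hyx⟩
  -- smoothness
  have hfsA : ContMDiffOn (𝓡 4) 𝓘(ℝ, ℝ) ∞ f A := contMDiffOn_ballFunction hFs hfA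
  have hfsO : ∀ x ∈ K, ContMDiffOn (𝓡 4) 𝓘(ℝ, ℝ) ∞ f (O x) := fun x hx =>
    (contDiff_oddProfile.contMDiff.comp_contMDiffOn (hσO x hx)).congr fun y hy => hfρ x hx y hy
  have hfs : ContMDiffOn (𝓡 4) 𝓘(ℝ, ℝ) ∞ f Ω := by
    intro y hy
    rcases hΩcases y hy with hyA | ⟨x, hx, hyx⟩
    · exact (hfsA.contMDiffAt (hAo.mem_nhds hyA)).contMDiffWithinAt
    · exact ((hfsO x hx).contMDiffAt ((hOo x hx).mem_nhds hyx)).contMDiffWithinAt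
  -- the sublevel and the level
  have hle : ∀ y ∈ Ω, f y ≤ 0 → y ∈ closure A := by
    intro y hy hfy
    by_contra hyc
    rcases hΩcases y hy with hyA | ⟨x, hx, hyx⟩
    · exact hyc (subset_closure hyA)
    · exact absurd hfy (not_le.2 (hfpos x hx y hyx hyc))
  have hlev1 : {x | x ∈ Ω ∧ f x ≤ 0} = closure A := by
    ext y
    refine ⟨fun hy => hle y hy.1 hy.2, fun hy => ⟨hclΩ hy, ?_⟩⟩
    rw [hclA] at hy
    rcases hy with hyA | hyK
    · exact (hfneg y hyA).le
    · exact (hfK y hyK).le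
  have hlev2 : {x | x ∈ Ω ∧ f x = 0} = K := by
    ext y
    refine ⟨fun hy => ?_, fun hyK => ⟨hKΩ y hyK, hfK y hyK⟩⟩
    have hyc := hle y hy.1 hy.2.le
    rw [hclA] at hyc
    rcases hyc with hyA | hyK
    · exact absurd hy.2 (hfneg y hyA).ne
    · exact hyK
  -- critical points
  have hdF : ∀ x ∈ A, Function.Bijective (mfderiv (𝓡 4) 𝓘(ℝ, 𝔼 4) F x) := by
    intro x hx
    have hβd : MDifferentiableAt (𝓡 4) (𝓡 4) (β i) x :=
      (hβ.contMDiffAt (hUo.mem_nhds (hAU hx))).mdifferentiableAt (by simp)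
    have hΨd : MDifferentiableAt (𝓡 4) 𝓘(ℝ, 𝔼 4) Ψ (β i x) :=
      (hΨ.contMDiffAt (hBc.isOpen_compl.mem_nhds (hβAc x hx))).mdifferentiableAt (by simp)
    have key : ⇑(mfderiv (𝓡 4) 𝓘(ℝ, 𝔼 4) F x) =
        ⇑(mfderiv (𝓡 4) 𝓘(ℝ, 𝔼 4) Ψ (β i x)) ∘ ⇑(mfderiv (𝓡 4) (𝓡 4) (β i) x) := by
      funext v
      show (mfderiv (𝓡 4) 𝓘(ℝ, 𝔼 4) (Ψ ∘ β i) x) v = _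
      rw [mfderiv_comp x hΨd hβd]
      rfl
    rw [key]
    exact (hdΨ _ (hβAc x hx)).comp (hdβ x hx)
  have hcrit : ∀ y ∈ Ω, f y ≤ 0 → mfderiv (𝓡 4) 𝓘(ℝ, ℝ) f y = 0 → y = p := by
    intro y hy hfy h0
    have hyc := hle y hy hfy
    rw [hclA] at hyc
    rcases hyc with hyA | hyK
    · have hFy : F y = 0 := apply_eq_zero_of_mfderiv_eq_zero hAo hFs hfA hyA (hdF y hyA).2 h0
      have hinj : Set.InjOn F A := hΨinj.comp hβinj fun x hx => hβAc x hx
      exact hinj hyA hpA (hFy.trans hFp.symm)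
    · exfalso
      have hev : f =ᶠ[𝓝 y] (fun s : ℝ => -s * (√(1 + s ^ 2))⁻¹) ∘ σ := by
        filter_upwards [(hOo y hyK).mem_nhds (hxO y hyK)] with w hw
        exact hfρ y hyK w hw
      have hσd : MDifferentiableAt (𝓡 4) 𝓘(ℝ, ℝ) σ y :=
        ((hσO y hyK).contMDiffAt ((hOo y hyK).mem_nhds (hxO y hyK))).mdifferentiableAt (by simp)
      have h := mfderiv_comp_ne_zero hσd (hasDerivAt_oddProfile (σ y))
        (deriv_oddProfile_ne_zero (σ y)) (hdσ y hyK y ⟨hxO y hyK, hyK⟩)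
      rw [← hev.mfderiv_eq] at h
      exact h h0
  obtain ⟨hdfp, hHess⟩ :=
    mfderiv_eq_zero_and_posDef_mhessian hAo hFs hfA hpA hFp (hdF p hpA).1
  exact ⟨Ω, f, p, hΩo, hfs, hclΩ, hlev1, hlev2, hpA, hfneg p hpA, hcrit, hdfp, hHess⟩

end Summit.SmoothPoincare4.SmoothPoincare4.Theorems.OrigamiRung.PairRigidityEndgame

end
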